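import Summits.CriticalPhenomena.PercolationContinuityZ3.Theorems.PercNearOneGluingNoHeavyQuantFarHairyCycleReach
import HarnessLib

/-!
# FAR beyond trees: the SUN GRAPH `C_{K+1}` for general `K`, hairy-cycle data, segments and edge bookkeeping

builds on p205010 (kernel theorem, internal audit signed; external expert review pending)

Support file (`--supports stmt-CriticalPhenomena-4575`), seat `prim-cert-1` (gen 18); QUANT lane rung R8, front "FAR beyond trees" (lead g20).
First half of the SEGMENT REDUCTION (`HairyCycle.farp_of_sun`, `…QuantFarHairyCycle`): FAR on a hairy cycle of any length follows from FAR
on the sun graph `C_{K+1}` with one hair per non-observer vertex.  A HAIRY CYCLE is a cycle `c_0 = o, c_1, …, c_{L−1}, c_0` (`L ≥ 3`) through the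
observer with `K ≥ 2` pendant relays: hair `k` is the edge `s(c_{b_k}, t_k)` to the tip `t_k` (tips distinct and off the cycle, bases
`b_0 ≤ b_1 ≤ ⋯ ≤ b_{K−1} < L`; several hairs per cycle vertex and hairs at the observer allowed) — `HairyCycle.IsHairyCycle`.

* `sunCyc K`, `sunTip K`, `sunBase`, `sunEs K`, `sunAs K` — the sun graph on `Fin (2K+1)` (`= sun3_es, …` of `…QuantFarSunCert` for `K = 3,4,5`),
  `mem_Eset_sunEs_iff`, `sunAs_toFinset`, `isHairyCycle_sun`;
* `seg K base m` — the sun segment of the cycle edge `e_m` (number of hairs with base `≤ m`); `seg_le_iff` (`seg m ≤ k ⟺ m < b_k`);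
* `cycE_inj`, `hairE_inj`, `hairE_ne_cycE`, `cycE_not_isDiag`, `hairE_not_isDiag` — the `L + K` pairs of a hairy cycle are distinct non-loops.
No measure theory; no sorries; standard axioms.
[cite: KozmaNitzan2024, Conjecture 3 (p. 15)] (context); elementary bookkeeping otherwise [this work].
-/

noncomputable section

namespace Summit.CriticalPhenomena.PercolationContinuityZ3.Theorems.HairyCycle

open Finset
open Literature.Probability.Percolation
open Summit.CriticalPhenomena.PercolationContinuityZ3.Theorems.AdditiveGluing.Negative.Cert

/-! ## The sun graph for general `K` -/

/-- Cycle vertices of the sun graph: `i ↦ i` in `Fin (2K+1)` (junk beyond). [this work] -/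
def sunCyc (K : ℕ) (i : ℕ) : Fin (2 * K + 1) := ⟨i % (2 * K + 1), Nat.mod_lt _ (by omega)⟩

/-- Tips of the sun graph: `k ↦ K + 1 + k` (junk beyond). [this work] -/
def sunTip (K : ℕ) (k : ℕ) : Fin (2 * K + 1) := ⟨(K + 1 + k) % (2 * K + 1), Nat.mod_lt _ (by omega)⟩

/-- Bases of the sun graph: hair `k` sits at cycle position `k + 1`. [this work] -/
def sunBase (k : ℕ) : ℕ := k + 1

/-- Edge list of the sun graph: cycle edges `(i, i+1 mod (K+1))`, then hairs `(k+1, K+1+k)`. [this work] -/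
def sunEs (K : ℕ) : List (Fin (2 * K + 1) × Fin (2 * K + 1)) :=
  ((List.range (K + 1)).map fun i => (sunCyc K i, sunCyc K ((i + 1) % (K + 1)))) ++
    ((List.range K).map fun k => (sunCyc K (k + 1), sunTip K k))

/-- Relay list of the sun graph: the tips. [this work] -/
def sunAs (K : ℕ) : List (Fin (2 * K + 1)) := (List.range K).map (sunTip K)

/-- Value of a sun cycle vertex. [this work] -/
theorem sunCyc_val (K : ℕ) {i : ℕ} (hi : i < 2 * K + 1) : (sunCyc K i : ℕ) = i := by
  unfold sunCyc; exact Nat.mod_eq_of_lt hi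

/-- Value of a sun tip. [this work] -/
theorem sunTip_val (K : ℕ) {k : ℕ} (hk : k < K) : (sunTip K k : ℕ) = K + 1 + k := by
  unfold sunTip; exact Nat.mod_eq_of_lt (by omega)

/-- The sun cycle is injective below `K + 1`. [this work] -/
theorem sunCyc_inj (K : ℕ) : ∀ i j, i < K + 1 → j < K + 1 → sunCyc K i = sunCyc K j → i = j := by
  intro i j hi hj h
  have := congrArg Fin.val h
  rwa [sunCyc_val K (by omega), sunCyc_val K (by omega)] at this

/-- The sun tips are injective below `K`. [this work] -/
theorem sunTip_inj (K : ℕ) : ∀ k k', k < K → k' < K → sunTip K k = sunTip K k' → k = k' := by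
  intro k k' hk hk' h
  have := congrArg Fin.val h
  rw [sunTip_val K hk, sunTip_val K hk'] at this
  omega

/-- The sun tips are off the sun cycle. [this work] -/
theorem sunTip_ne_cyc (K : ℕ) : ∀ k i, k < K → i < K + 1 → sunTip K k ≠ sunCyc K i := by
  intro k i hk hi h
  have := congrArg Fin.val h
  rw [sunTip_val K hk, sunCyc_val K (by omega)] at this
  omega

/-- Membership in the edge set of the sun graph. [this work] -/
theorem mem_Eset_sunEs_iff (K : ℕ) (e : Sym2 (Fin (2 * K + 1))) :
    e ∈ Eset (sunEs K) ↔ (∃ i, i < K + 1 ∧ e = cycE (K + 1) (sunCyc K) i) ∨ (∃ k, k < K ∧ e = hairE (sunCyc K) sunBase (sunTip K) k) := by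
  unfold Eset sunEs cycE hairE sunBase
  rw [List.mem_toFinset, List.map_append, List.mem_append]
  simp only [List.map_map, List.mem_map, List.mem_range, Function.comp_apply, mkE]
  constructor
  · rintro (⟨i, hi, rfl⟩ | ⟨k, hk, rfl⟩)
    · exact Or.inl ⟨i, hi, rfl⟩
    · exact Or.inr ⟨k, hk, rfl⟩
  · rintro (⟨i, hi, rfl⟩ | ⟨k, hk, rfl⟩)
    · exact Or.inl ⟨i, hi, rfl⟩
    · exact Or.inr ⟨k, hk, rfl⟩

/-- The relay finset of the sun graph is the image of the tips. [this work] -/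
theorem sunAs_toFinset (K : ℕ) : (sunAs K).toFinset = (Finset.range K).image (sunTip K) := by
  unfold sunAs
  ext x
  simp [List.mem_toFinset]

/-! ## The segment index of a cycle edge -/

variable {n : ℕ}

/-- The hypotheses of a hairy cycle with `K ≥ 2` hairs: cycle of length `L ≥ 3` injective, bases on the cycle and monotone,
tips injective and off the cycle. [this work] -/
structure IsHairyCycle (L : ℕ) (cyc : ℕ → Fin n) (K : ℕ) (base : ℕ → ℕ) (tip : ℕ → Fin n) : Prop where
  hL : 3 ≤ L
  hK : 2 ≤ K
  hcyc : ∀ i j, i < L → j < L → cyc i = cyc j → i = j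
  hbase : ∀ k, k < K → base k < L
  htip : ∀ k k', k < K → k' < K → tip k = tip k' → k = k'
  hoff : ∀ k i, k < K → i < L → tip k ≠ cyc i
  hmono : ∀ k k', k ≤ k' → k' < K → base k ≤ base k'

/-- The sun graph is a hairy cycle. [this work] -/
theorem isHairyCycle_sun {K : ℕ} (hK : 2 ≤ K) : IsHairyCycle (K + 1) (sunCyc K) K sunBase (sunTip K) where
  hL := by omega
  hK := hK
  hcyc := sunCyc_inj K
  hbase := fun k hk => by unfold sunBase; omega
  htip := sunTip_inj K
  hoff := sunTip_ne_cyc K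
  hmono := fun k k' hkk' _ => by unfold sunBase; omega

/-- The sun segment of the cycle edge `e_m`: the number of hairs with base `≤ m`. [this work] -/
def seg (K : ℕ) (base : ℕ → ℕ) (m : ℕ) : ℕ := ((Finset.range K).filter fun k => base k ≤ m).card

/-- `seg m ≤ k ⟺ m < b_k` for `k < K` (bases monotone). [this work] -/
theorem seg_le_iff {K : ℕ} {base : ℕ → ℕ} (hmono : ∀ k k', k ≤ k' → k' < K → base k ≤ base k') {m k : ℕ} (hk : k < K) :
    seg K base m ≤ k ↔ m < base k := by
  unfold seg
  constructor
  · intro h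
    by_contra hmk
    push Not at hmk
    have hsub : Finset.range (k + 1) ⊆ (Finset.range K).filter fun k' => base k' ≤ m := by
      intro k' hk'
      rw [Finset.mem_range] at hk'
      rw [Finset.mem_filter, Finset.mem_range]
      exact ⟨by omega, (hmono k' k (by omega) hk).trans hmk⟩
    have := Finset.card_le_card hsub
    rw [Finset.card_range] at this
    omega
  · intro h
    have hsub : ((Finset.range K).filter fun k' => base k' ≤ m) ⊆ Finset.range k := by
      intro k' hk'
      rw [Finset.mem_filter, Finset.mem_range] at hk'
      rw [Finset.mem_range]
      by_contra hkk
      push Not at hkk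
      have := hmono k k' hkk hk'.1
      omega
    have := Finset.card_le_card hsub
    rwa [Finset.card_range] at this

/-- `seg m ≤ K`. [this work] -/
theorem seg_le (K : ℕ) (base : ℕ → ℕ) (m : ℕ) : seg K base m ≤ K := by
  unfold seg
  exact (Finset.card_le_card (Finset.filter_subset _ _)).trans (by rw [Finset.card_range])

/-! ## Injectivity of the edges of a hairy cycle -/

variable {L : ℕ} {cyc : ℕ → Fin n} {K : ℕ} {base : ℕ → ℕ} {tip : ℕ → Fin n}

/-- Cycle edges are distinct (`L ≥ 3`). [this work] -/
theorem cycE_inj (H : IsHairyCycle L cyc K base tip) {i i' : ℕ} (hi : i < L) (hi' : i' < L)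
    (h : cycE L cyc i = cycE L cyc i') : i = i' := by
  have hL := H.hL
  have h' : s(cyc i, cyc ((i + 1) % L)) = cycE L cyc i' := h
  rcases cycE_eq_iff L cyc H.hL H.hcyc hi (Nat.mod_lt _ (by omega)) hi' h' with ⟨h1, -⟩ | ⟨h1, h2⟩
  · exact h1
  · exfalso
    by_cases hlt : i' + 1 < L
    · rw [Nat.mod_eq_of_lt hlt] at h1
      subst h1
      by_cases hlt2 : i' + 1 + 1 < L
      · rw [Nat.mod_eq_of_lt hlt2] at h2; omega
      · have : i' + 1 + 1 = L := by omega
        rw [this, Nat.mod_self] at h2; omega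
    · have h3 : i' + 1 = L := by omega
      rw [h3, Nat.mod_self] at h1
      subst h1
      rw [Nat.mod_eq_of_lt (by omega : 0 + 1 < L)] at h2
      omega

/-- Hair edges are distinct. [this work] -/
theorem hairE_inj (H : IsHairyCycle L cyc K base tip) {k k' : ℕ} (hk : k < K) (hk' : k' < K)
    (h : hairE cyc base tip k = hairE cyc base tip k') : k = k' := by
  unfold hairE at h
  rcases Sym2.eq_iff.1 h with ⟨-, h2⟩ | ⟨h1, -⟩
  · exact H.htip _ _ hk hk' h2
  · exact absurd h1.symm (H.hoff k' _ hk' (H.hbase k hk))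

/-- A hair edge is not a cycle edge. [this work] -/
theorem hairE_ne_cycE (H : IsHairyCycle L cyc K base tip) {k i : ℕ} (hk : k < K) (hi : i < L) :
    hairE cyc base tip k ≠ cycE L cyc i := by
  have hL := H.hL
  intro h
  unfold hairE cycE at h
  rcases Sym2.eq_iff.1 h with ⟨-, h2⟩ | ⟨-, h2⟩
  · exact H.hoff k _ hk (Nat.mod_lt _ (by omega)) h2
  · exact H.hoff k _ hk hi h2

/-- A cycle edge is not a loop. [this work] -/
theorem cycE_not_isDiag (H : IsHairyCycle L cyc K base tip) {i : ℕ} (hi : i < L) : ¬ (cycE L cyc i).IsDiag := by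
  have hL := H.hL
  unfold cycE
  rw [Sym2.mk_isDiag_iff]
  intro h
  have := H.hcyc _ _ hi (Nat.mod_lt _ (by omega)) h
  by_cases hlt : i + 1 < L
  · rw [Nat.mod_eq_of_lt hlt] at this; omega
  · have h3 : i + 1 = L := by omega
    rw [h3, Nat.mod_self] at this; omega

/-- A hair edge is not a loop. [this work] -/
theorem hairE_not_isDiag (H : IsHairyCycle L cyc K base tip) {k : ℕ} (hk : k < K) : ¬ (hairE cyc base tip k).IsDiag := by
  unfold hairE
  rw [Sym2.mk_isDiag_iff]
  exact fun h => H.hoff k _ hk (H.hbase k hk) h.symm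

end Summit.CriticalPhenomena.PercolationContinuityZ3.Theorems.HairyCycle

end
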